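import Summits.MatrixMultiplication.MatrixMultiplication.Theses.ThinBlockAlpha
import Summits.MatrixMultiplication.MatrixMultiplication.Theorems.RectangularThmB.Negative.TwoLegTranslate
import Literature.Computability.AlgebraicComplexity.QuantumFunctionals
import Literature.Computability.AlgebraicComplexity.SupportFunctionalRestriction
import Literature.Computability.AlgebraicComplexity.SupportFunctionalPowers
import Literature.Computability.AlgebraicComplexity.UpperSupportFunctionalMatMul
import Literature.Computability.AlgebraicComplexity.GroupTheoreticMatMulProofs

/-!
# Skeleton line `weighted-support-spectrum` for crux `RectangularThmB` (stmt-MatrixMultiplication-10597)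

Route `ThinBlockAlpha`, crux rank 4 `RectangularThmB` ("rectangular Theorem B"):
`∀ ℓ, ∀ a ∈ (0,1), ∃ η > 0, ∀ H` finite abelian of exponent `≤ ℓ`, every STPP family of `L` blocks
`⟨N, M, N⟩`, `N ≥ 2`, `N^a ≤ M`, has `L · N^{2+η} < |H|`.
Planner skeleton, crux-plan round 1 (planner-cruxplan-stmt-MatrixMultiplication-10597-weighted-support-spe-0,
2026-08-16); idea card `weighted-support-spectrum` (crux-ideate r1, ideator 1; triage r1: 3 × pass AS A
PARTIAL LEVER; merge group {weighted-support-spectrum ≈ kronecker-multiplicity-clp ≈ clp-annihilator-sum-graph},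
one inequality in three presentations — this file is the SPECTRAL presentation, stated over the tree's
Strassen support functionals, whose needed properties are PROVED in the tree).

## The line: tilted support functionals force huge blocks; the crux is its huge-block case

Let `T_K(H) = [x + y = z]` be the structure tensor of the group algebra `K[H]` (legs `(z, x, y)`, the
tree's convention in `GroupTheoreticMatMulProofs.tensorRank_addGroupAlgTensor_le`) and
`ρ^θ = logUpperSupportFunctional θ` Strassen's logarithmic upper support functional (CVZ Def. 2.3,
`QuantumFunctionals.lean`), with the TILTED weight `θ_s = (1 − 2s, s, s)`: almost all weight on the
OUTPUT leg, which under the CKSU restriction `T_K(H) ≥ ⊕ᵢ ⟨|Aᵢ|,|Bᵢ|,|Cᵢ|⟩`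
(`matMulDirectSum_eq_precomp_of_isSTPP`) is the leg indexed by the two-leg difference sets `Aᵢ − Cᵢ`.

* LOWER BOUND (`stub_functionalPacking`, provable now, size M): `⊕ᵢ ⟨N,M,N⟩` is oblique (block-lex
  orders), so Strassen's oblique restriction theorem (tree
  `weightedEntropy_le_logUpperSupportFunctional_of_restrictsTo`) applied to the UNIFORM distribution on
  its support gives `θ₀ log₂(L N²) + θ₁ log₂(L N M) + θ₂ log₂(L M N) ≤ ρ^θ(T_K(H))` for every field `K`
  and every `θ ≥ 0`; at `θ_s`: `log₂ L + (2 − 2s) log₂ N + 2s log₂ M ≤ ρ^{θ_s}(T_K(H))`.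
* UPPER BOUND WITH A GAP (`stub_supportEntropyGap`, provable, size M/L): for `H` of exponent `≤ ℓ` and a
  prime `p` carrying the largest primary part `H_p` (`|H_p| ≥ |H|^{1/π(ℓ)}`), over `K = 𝔽_p` the basis
  `∏ⱼ (gⱼ − 1)^{eⱼ}` of `K[H_p] ≅ ⊗ⱼ K[x]/(x^{qⱼ})` makes every cyclic factor TIGHT (support
  `{(k, i, j) : k = i + j < q}`), so `ρ^θ(T_K(H)) ≤ Σⱼ H_θ(supp t_{qⱼ}) + log₂|H/H_p|` (coordinatewise
  entropy subadditivity, tree `SupportFunctionalPowers.weightedEntropy_le_sum_coordinates`), and for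
  `0 < s < 1/2` each tight factor has a GAP `H_{θ_s}(supp t_q) ≤ (1 − δ_q(s)) log₂ q`, `δ_q(s) > 0`
  (Gibbs' inequality with the geometric dual weights `Q_x(i) = Q_y(i) ∝ r^i`, `Q_z(k) ∝ r^{−sk/(1−2s)}`,
  `r < 1`: the score is constant `= (1−2s) log₂ Σ_{k<q} r^{−sk/(1−2s)} + 2s log₂ Σ_{i<q} rⁱ`, whose
  `r`-derivative at `r = 1` is `s(q−1)/(2 ln 2) > 0`). Numerically the optimal slope is
  `lim_{s→0} δ_q(s)/(2s) = I_q(1/4)` (= `.1887/.1797/.1717/.1649/.1543` for `q = 2,3,4,5,7`; triage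
  r1-1/2/3, three independent recomputations).
* REGIME LEMMA (`smallBlocks_of`, PROVED below from the two stubs, pure `log₂` bookkeeping): for every
  `ℓ` there is `κ > 0` such that for all `a ∈ (0,1)` and `ν > 0` with `ν(1−a) < κ` some `η > 0` excludes
  every thin family with SMALL blocks `N ≤ |H|^ν`: with `L N^{2+η} ≥ |H|`, `M ≥ N^a`:
  `log₂|H| − η log₂ N − 2s(1−a) log₂ N ≤ log₂ L + (2−2s) log₂ N + 2s log₂ M ≤ (1−δ) log₂|H|`, i.e.
  `δ log₂|H| ≤ (η + 2s(1−a)) log₂ N ≤ ν(η + 2s(1−a)) log₂|H|`, impossible once `ν(η + 2s(1−a)) < δ`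
  (`κ = δ/(2s)`).
* RESIDUAL (`stub_hugeBlocks`, HARDEST = the crux on its hard regime, size XL/open): thin near-tight
  families with HUGE blocks `N ≥ |H|^ν` (any fixed `ν > 0`) do not exist in bounded exponent. HONEST
  STATUS: this is where the crux lives — the lever is silent there, the regime contains the route's own
  engine (CKSU Thm 33 designs over skew local strong USPs of class `(3k,k,3k)` in `Cyc₇^{7k}` sit at
  `ν = 3 ln 6/(7 ln 7) = 0.394 > κ₇/(1 − 1/3) ≈ 0.23`), so `stub_hugeBlocks → ¬ SkewLocalStrongUSP`
  (via `USPToBounded` and the fork `RectangularThmB → ¬ BoundedExponentThird` restricted to that family);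
  no why-easier is claimed for it. The contradiction threshold of the lever ALONE is
  `ν_max = 1/(2+a) < κ_ℓ/(1−a)` iff `a > a₁(ℓ) = (1−2κ_ℓ)/(1+κ_ℓ) ≥ 0.52`.
* COMPOSITION (`RectangularThmB_of`, sorry-free): `ν := κ/(2(1−a))`, `η := min(η_small, η_huge)`, case
  split on `|H|^ν ≤ N`.

## Disproof.lean (cdisprove, 02:31Z) — what this line honours
`rectangularThmB_false_without_N_ge_two` / `_false_without_pos_a`: both hypotheses are USED — `N ≥ 2`
makes `log₂ N > 0` in `smallBlocks_of` and is passed to `stub_hugeBlocks`; `a > 0` enters through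
`M ≥ N^a` (`2s·a·log₂ N` is the whole gain of the tilt) and `a < 1` through `ν = κ/(2(1−a))`.
`eta_le_a` / `not_uniform_eta` / `not_uniform_linear_eta`: the `η` produced here is
`min(s(1−a), η_huge(ℓ, ν, a))` with `ν = δ/(4s(1−a))` (`smallBlocks_of`: `κ = δ/(2s)`,
`η_small = δ/(2ν) − s(1−a)`), so its degeneration as `a → 0⁺` (forced by `eta_le_a`) must come from
`stub_hugeBlocks` — consistent, and a reminder that the residual carries the quantitative content.
`rectangularThmB_iff_small_a` + `inner_of_thmB`: acknowledged — the lever's unconditional reach is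
`a > a₁(ℓ)` (better than `inner_of_thmB`'s `a₀(ℓ) = (2−2ε_ℓ)/(2+ε_ℓ)`, e.g. `.6725 → .5237` at `ℓ = 2`),
the small-`a` tail is delegated to `stub_hugeBlocks`. `succ_mul_sq_le_card` (landed
`Theorems/RectangularThmB/Negative/TwoLegTranslate.lean`, imported): no stub is an instance it refutes
(it refutes only EXACT two-leg tightness of a single family). Negatives index (4 entries): none related.
-/

set_option linter.dupNamespace false

noncomputable section

namespace Summit.MatrixMultiplication.MatrixMultiplication.Cruxes.RectangularThmB.WeightedSupportSpectrum

open Literature.Computability.AlgebraicComplexity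
open Summit.MatrixMultiplication.MatrixMultiplication.Theses.ThinBlockAlpha

/-! ### The three statements, named -/

/-- **Spectral packing bound** (the lever's lower half): for every field `K`, every `θ ≥ 0` and every
STPP family with blocks `⟨N, M, N⟩` in a finite abelian group `H`, the `θ`-weighted entropy of the
uniform distribution on the support of `⊕ᵢ ⟨N, M, N⟩` is at most `ρ^θ` of the structure tensor
`[x + y = z]` of `K[H]`:
`θ₀ log₂(L·N·N) + θ₁ log₂(L·N·M) + θ₂ log₂(L·M·N) ≤ ρ^θ(T_K(H))`.
(Registered stub: `stub_functionalPacking`; composition hypothesis: `Registered.stub_functionalPacking`.) -/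
def FunctionalPacking : Prop :=
  ∀ (K : Type) [Field K] (θ : Fin 3 → ℝ), (∀ i, 0 ≤ θ i) →
    ∀ (H : Type) [AddCommGroup H] [Fintype H] [DecidableEq H] (L N M : ℕ)
      (A B C : Fin L → Finset H), IsSTPP A B C →
      (∀ i, (A i).card = N ∧ (B i).card = M ∧ (C i).card = N) → 1 ≤ L → 1 ≤ N → 1 ≤ M →
      θ 0 * Real.logb 2 ((L : ℝ) * N * N) + θ 1 * Real.logb 2 ((L : ℝ) * N * M) +
          θ 2 * Real.logb 2 ((L : ℝ) * M * N) ≤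
        logUpperSupportFunctional θ (fun z x y : H => if x + y = z then (1 : K) else 0)

/-- **Tilted support-entropy gap in bounded exponent** (the lever's upper half): for every `ℓ` there
are a tilt `0 < s < 1/2` and a gap `δ > 0` such that every finite abelian `H` of exponent `≤ ℓ` has,
over SOME field `K` (a prime field `𝔽_p`, `p` the prime with the largest primary part of `H`),
`ρ^{(1−2s, s, s)}(T_K(H)) ≤ (1 − δ) log₂ |H|`.
(Registered stub: `stub_supportEntropyGap`; composition hypothesis: `Registered.stub_supportEntropyGap`.) -/
def SupportEntropyGap : Prop :=
  ∀ ℓ : ℕ, ∃ s : ℝ, 0 < s ∧ s < 1 / 2 ∧ ∃ δ : ℝ, 0 < δ ∧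
    ∀ (H : Type) [AddCommGroup H] [Fintype H] [DecidableEq H], AddMonoid.exponent H ≤ ℓ →
      ∃ (K : Type) (_ : Field K),
        logUpperSupportFunctional ![1 - 2 * s, s, s]
            (fun z x y : H => if x + y = z then (1 : K) else 0) ≤
          (1 - δ) * Real.logb 2 (Fintype.card H)

/-- **The huge-block residual** (= the crux restricted to blocks of polynomial size `N ≥ |H|^ν`, for
each fixed `ν > 0`). (Registered stub: `stub_hugeBlocks`; composition hypothesis:
`Registered.stub_hugeBlocks`.) -/
def HugeBlocks : Prop :=
  ∀ ℓ : ℕ, ∀ ν : ℝ, 0 < ν → ∀ a : ℝ, 0 < a → a < 1 → ∃ η : ℝ, 0 < η ∧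
    ∀ (H : Type) [AddCommGroup H] [Fintype H], AddMonoid.exponent H ≤ ℓ →
      ∀ (L N M : ℕ) (A B C : Fin L → Finset H), IsSTPP A B C →
        (∀ i, (A i).card = N ∧ (B i).card = M ∧ (C i).card = N) → 2 ≤ N →
        (N : ℝ) ^ a ≤ M → (Fintype.card H : ℝ) ^ ν ≤ N →
        (L : ℝ) * (N : ℝ) ^ (2 + η) < Fintype.card H

/-- **The small-block regime** (DERIVED below from the two halves of the lever; not a stub): for every
`ℓ` there is `κ > 0` such that for all `a ∈ (0,1)`, `ν > 0` with `ν(1−a) < κ`, some `η > 0` excludes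
every exponent-`≤ ℓ` thin family with `N ≤ |H|^ν`. -/
def SmallBlocks : Prop :=
  ∀ ℓ : ℕ, ∃ κ : ℝ, 0 < κ ∧ ∀ a : ℝ, 0 < a → a < 1 → ∀ ν : ℝ, 0 < ν → ν * (1 - a) < κ →
    ∃ η : ℝ, 0 < η ∧
      ∀ (H : Type) [AddCommGroup H] [Fintype H], AddMonoid.exponent H ≤ ℓ →
        ∀ (L N M : ℕ) (A B C : Fin L → Finset H), IsSTPP A B C →
          (∀ i, (A i).card = N ∧ (B i).card = M ∧ (C i).card = N) → 2 ≤ N →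
          (N : ℝ) ^ a ≤ M → (N : ℝ) ≤ (Fintype.card H : ℝ) ^ ν →
          (L : ℝ) * (N : ℝ) ^ (2 + η) < Fintype.card H

/-! ### The registered stubs (statements expanded over existing declarations) -/

/-- STUB A (M, PROVABLE NOW) — `FunctionalPacking` expanded. Proof route: (1) CKSU Thm 5.3 restriction
`T_K(H) ≥ ⊕ᵢ ⟨|Aᵢ|,|Bᵢ|,|Cᵢ|⟩ = matMulDirectSum K N M N` (`matMulDirectSum_eq_precomp_of_isSTPP` +
`tensorRestrictsTo_precomp`); (2) `supp (matMulDirectSum)` is an antichain for block-lexicographic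
weights: first the block index, with OPPOSITE orientations on legs 1 and 2 (so comparable support
points lie in one block), then the one-block weights of `matMulTensor_support_antichain`
(`injective_matMulWeight₁/₂/₃`); (3) `weightedEntropy_le_logUpperSupportFunctional_of_restrictsTo` with `P` uniform on the
support (`L·N·M·N` points), whose marginals are uniform on the three legs (`uniform_matMul_spec` per
block), `H(uniform on n points) = log₂ n` (`shannonEntropy_const_inv_card`); the blocks `Fin |Aᵢ|`
vs `Fin N` are identified through `hc` (state the entropy computation for general card functions).
Why it might fail: it does not ([Str91, §4] = CVZ arXiv:1709.07851 Thm 2.19 along a restriction, all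
ingredients tree-proved); bookkeeping only. -/
theorem stub_functionalPacking :
    ∀ (K : Type) [Field K] (θ : Fin 3 → ℝ), (∀ i, 0 ≤ θ i) →
      ∀ (H : Type) [AddCommGroup H] [Fintype H] [DecidableEq H] (L N M : ℕ)
        (A B C : Fin L → Finset H), IsSTPP A B C →
        (∀ i, (A i).card = N ∧ (B i).card = M ∧ (C i).card = N) → 1 ≤ L → 1 ≤ N → 1 ≤ M →
        θ 0 * Real.logb 2 ((L : ℝ) * N * N) + θ 1 * Real.logb 2 ((L : ℝ) * N * M) +
            θ 2 * Real.logb 2 ((L : ℝ) * M * N) ≤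
          logUpperSupportFunctional θ (fun z x y : H => if x + y = z then (1 : K) else 0) := by
  sorry

/-- STUB B (M/L, PROVABLE) — `SupportEntropyGap` expanded. Proof route: fix `s := 1/4` (any
`0 < s < 1/2` works). For `H` of exponent `e ≤ ℓ` write `H ≅ H_p × H'` with `H_p` the `p`-primary part
of largest order, `|H_p| ≥ |H|^{1/ω(e)}`, `ω(e) ≤ ℓ` the number of primes dividing `e`; take `K = ZMod p`.
(1) Basis change is a `GL³`-action: the structure tensor in a basis `b = P·(group basis)` is
`actTensor (P⁻¹)ᵀ P P (T_K(H))`, so `ρ^θ ≤ H_θ(supp)` in ANY basis (`ciInf_le`). (2) In the basis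
`∏ⱼ (gⱼ − 1)^{eⱼ}` (`0 ≤ eⱼ < qⱼ = p^{rⱼ}`; `(g−1)^{p^r} = g^{p^r} − 1 = 0` in characteristic `p`,
`sub_pow_char_pow`) tensored with the group basis of `H'`, the support is the product of the tight
supports `{(k,i,j) : k = i + j < qⱼ}` and `supp T_K(H')`. (3) Coordinatewise subadditivity
`H_θ(P) ≤ Σ_coords H_θ(P⁽ᶜ⁾)` (`weightedEntropy_le_sum_coordinates`, embed all alphabets in one
`Fin m`) and the trivial bound `H_θ ≤ log₂ |alphabet|` on the `H'` coordinates
(`shannonEntropy_le_of_mem_stdSimplex`). (4) The one-coordinate gap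
`H_{θ_s}(supp t_q) ≤ (1 − δ_q) log₂ q`, `δ_q > 0`, by Gibbs (`shannonEntropy_le_sum_mul_neg_logb`,
WeightedEntropyMax.lean) with geometric duals (module docstring); `δ := min_{q ≤ ℓ} δ_q / ℓ`.
Why it might fail: it does not for prime-power cyclic factors in their own characteristic (this is
the BCCGNSU/KSS tight-basis trick); the only subtlety is mixed primes — handled by paying `log₂|H'|`
in full and keeping the gap on the largest primary part (factor `1/ω(e)`), as stated (`∃ K` AFTER `H`). -/
theorem stub_supportEntropyGap :
    ∀ ℓ : ℕ, ∃ s : ℝ, 0 < s ∧ s < 1 / 2 ∧ ∃ δ : ℝ, 0 < δ ∧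
      ∀ (H : Type) [AddCommGroup H] [Fintype H] [DecidableEq H], AddMonoid.exponent H ≤ ℓ →
        ∃ (K : Type) (_ : Field K),
          logUpperSupportFunctional ![1 - 2 * s, s, s]
              (fun z x y : H => if x + y = z then (1 : K) else 0) ≤
            (1 - δ) * Real.logb 2 (Fintype.card H) := by
  sorry

/-- STUB C (XL, OPEN, HARDEST) — `HugeBlocks` expanded: the crux on the regime the lever cannot see,
thin near-tight families whose blocks have size a fixed power of `|H|`. Why plausibly true: no
bounded-exponent thin design with two-leg exponent `η → 0` at fixed `a > 0` is known; the only
multi-block designs in Lean (Disproof §G, cyclic skew local strong USPs) have `η/a ≥ (1+o(1))/ln ℓ`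
and the route's `(3k,k,3k)` designs reach `η = 0.218` at width 14 (Disproof `resists` item 6). Why
it might fail: it contains the route's engine — `HugeBlocks → ¬ SkewLocalStrongUSP` (the CKSU
`Cyc₇^{7k}` designs have `ν = 0.394`), i.e. it asserts skew-USP sub-capacity in class `(3k,k,3k)`, an
open Sperner-capacity question (arXiv:math/0511460 §6, arXiv:1605.06702 §1); every round-1 line has
this statement inside its residual (triage r1-2 panel summary). -/
theorem stub_hugeBlocks :
    ∀ ℓ : ℕ, ∀ ν : ℝ, 0 < ν → ∀ a : ℝ, 0 < a → a < 1 → ∃ η : ℝ, 0 < η ∧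
      ∀ (H : Type) [AddCommGroup H] [Fintype H], AddMonoid.exponent H ≤ ℓ →
        ∀ (L N M : ℕ) (A B C : Fin L → Finset H), IsSTPP A B C →
          (∀ i, (A i).card = N ∧ (B i).card = M ∧ (C i).card = N) → 2 ≤ N →
          (N : ℝ) ^ a ≤ M → (Fintype.card H : ℝ) ^ ν ≤ N →
          (L : ℝ) * (N : ℝ) ^ (2 + η) < Fintype.card H := by
  sorry

/-! ### Consistency: each named statement IS its registered stub (definitionally) -/

theorem functionalPacking_holds : FunctionalPacking := stub_functionalPacking
theorem supportEntropyGap_holds : SupportEntropyGap := stub_supportEntropyGap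
theorem hugeBlocks_holds : HugeBlocks := stub_hugeBlocks

/-! ### Name-keyed aliases of the three statements (the hypotheses of the composition; the skeleton
audit admits a hypothesis only if its head constant is a registered obligation or is named like a
declared stub; the H21.Audit stub attribute itself is gate-reserved, hence aliases) -/
namespace Registered

/-- Alias of `FunctionalPacking` keyed by the registered stub name. -/
abbrev stub_functionalPacking : Prop := FunctionalPacking
/-- Alias of `SupportEntropyGap` keyed by the registered stub name. -/
abbrev stub_supportEntropyGap : Prop := SupportEntropyGap
/-- Alias of `HugeBlocks` keyed by the registered stub name. -/
abbrev stub_hugeBlocks : Prop := HugeBlocks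

end Registered


/-! ### Glue (PROVED): the regime lemma — small blocks are excluded by the two halves of the lever -/

/-- `log₂` of a triple product of nonzero reals. -/
theorem logb_mul_three {x y z : ℝ} (hx : x ≠ 0) (hy : y ≠ 0) (hz : z ≠ 0) :
    Real.logb 2 (x * y * z) = Real.logb 2 x + Real.logb 2 y + Real.logb 2 z := by
  rw [Real.logb_mul (mul_ne_zero hx hy) hz, Real.logb_mul hx hy]

/-- **The regime lemma.** `FunctionalPacking ∧ SupportEntropyGap ⇒ SmallBlocks`, with
`κ = δ/(2s)` and `η = (δ − 2νs(1−a))/(2ν)`: pure `log₂` bookkeeping (module docstring). -/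
theorem smallBlocks_of (hA : FunctionalPacking) (hB : SupportEntropyGap) : SmallBlocks := by
  intro ℓ
  obtain ⟨s, hs0, hs12, δ, hδ, hgap⟩ := hB ℓ
  refine ⟨δ / (2 * s), by positivity, ?_⟩
  intro a ha0 ha1 ν hν hνκ
  -- the slack: `ν (η + 2 s (1 - a)) < δ`
  have h2νs : 2 * ν * s * (1 - a) < δ := by
    have h := (lt_div_iff₀ (by positivity : (0 : ℝ) < 2 * s)).1 hνκ
    nlinarith
  set η : ℝ := (δ - 2 * ν * s * (1 - a)) / (2 * ν) with hηdef
  have hη0 : 0 < η := by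
    rw [hηdef]
    exact div_pos (by linarith) (by positivity)
  have hνη : ν * η = (δ - 2 * ν * s * (1 - a)) / 2 := by
    rw [hηdef]
    field_simp
  refine ⟨η, hη0, ?_⟩
  intro H _ _ hexp L N M A B C hS hc hN hM hsmall
  classical
  -- `L = 0`: the conclusion is `0 < |H|`
  rcases Nat.eq_zero_or_pos L with rfl | hL
  · simp [Fintype.card_pos]
  -- positivity bookkeeping
  have hN1 : (1 : ℝ) < N := by exact_mod_cast lt_of_lt_of_le one_lt_two hN
  have hNpos : (0 : ℝ) < N := by linarith
  have hN1' : (1 : ℝ) ≤ N := hN1.le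
  have hLpos : (0 : ℝ) < L := by exact_mod_cast hL
  have hL1 : (1 : ℝ) ≤ L := by exact_mod_cast hL
  have hNa1 : (1 : ℝ) ≤ (N : ℝ) ^ a := Real.one_le_rpow hN1' ha0.le
  have hM1 : (1 : ℝ) ≤ M := le_trans hNa1 hM
  have hMpos : (0 : ℝ) < M := by linarith
  have hM1nat : 1 ≤ M := by exact_mod_cast hM1
  have hHpos : (0 : ℝ) < Fintype.card H := by exact_mod_cast Fintype.card_pos
  -- `|H| > 1`: it contains `A i` of size `N ≥ 2`
  have hH1 : (1 : ℝ) < Fintype.card H := by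
    have h1 : (A ⟨0, hL⟩).card ≤ Fintype.card H := Finset.card_le_univ _
    rw [(hc ⟨0, hL⟩).1] at h1
    exact_mod_cast lt_of_lt_of_le (lt_of_lt_of_le one_lt_two hN) h1
  -- the logs
  set X : ℝ := Real.logb 2 L with hX
  set Y : ℝ := Real.logb 2 N with hY
  set Z : ℝ := Real.logb 2 M with hZ
  set W : ℝ := Real.logb 2 (Fintype.card H) with hW
  have hX0 : 0 ≤ X := Real.logb_nonneg one_lt_two hL1
  have hY0 : 0 < Y := Real.logb_pos one_lt_two hN1
  have hW0 : 0 < W := Real.logb_pos one_lt_two hH1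
  -- `a Y ≤ Z` from `N^a ≤ M`
  have haY : a * Y ≤ Z := by
    have h := Real.logb_le_logb_of_le one_lt_two (Real.rpow_pos_of_pos hNpos a) hM
    rwa [Real.logb_rpow_eq_mul_logb_of_pos hNpos] at h
  -- `Y ≤ ν W` from `N ≤ |H|^ν`
  have hYν : Y ≤ ν * W := by
    have h := Real.logb_le_logb_of_le one_lt_two hNpos hsmall
    rwa [Real.logb_rpow_eq_mul_logb_of_pos hHpos] at h
  -- the lever: `X + (2 - 2s) Y + 2 s Z ≤ (1 - δ) W`
  obtain ⟨K, instK, hρ⟩ := hgap H hexp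
  have hθ : ∀ i, 0 ≤ (![1 - 2 * s, s, s] : Fin 3 → ℝ) i := by
    intro i
    fin_cases i
    · show 0 ≤ 1 - 2 * s
      linarith
    · show 0 ≤ s
      exact hs0.le
    · show 0 ≤ s
      exact hs0.le
  have hN1nat : 1 ≤ N := le_trans (by norm_num) hN
  have hpack := hA K ![1 - 2 * s, s, s] hθ H L N M A B C hS hc hL hN1nat hM1nat
  have hlever : X + (2 - 2 * s) * Y + 2 * s * Z ≤ (1 - δ) * W := by
    have h := hpack.trans hρ
    have e0 : Real.logb 2 ((L : ℝ) * N * N) = X + Y + Y :=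
      logb_mul_three hLpos.ne' hNpos.ne' hNpos.ne'
    have e1 : Real.logb 2 ((L : ℝ) * N * M) = X + Y + Z :=
      logb_mul_three hLpos.ne' hNpos.ne' hMpos.ne'
    have e2 : Real.logb 2 ((L : ℝ) * M * N) = X + Z + Y :=
      logb_mul_three hLpos.ne' hMpos.ne' hNpos.ne'
    simp only [e0, e1, e2, Matrix.cons_val_zero, Matrix.cons_val_one, Matrix.head_cons,
      Matrix.cons_val_two, Matrix.tail_cons] at h
    linarith
  -- conclude in logs: `X + (2 + η) Y < W`
  have hsZ : s * (a * Y) ≤ s * Z := mul_le_mul_of_nonneg_left haY hs0.le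
  have hcoef : 0 ≤ η + 2 * s * (1 - a) := by nlinarith
  have hYν' : (η + 2 * s * (1 - a)) * Y ≤ (η + 2 * s * (1 - a)) * (ν * W) :=
    mul_le_mul_of_nonneg_left hYν hcoef
  have hslack : (η + 2 * s * (1 - a)) * ν < δ := by nlinarith
  have hslackW : (η + 2 * s * (1 - a)) * ν * W < δ * W := mul_lt_mul_of_pos_right hslack hW0
  have hlog : X + (2 + η) * Y < W := by nlinarith
  -- back to the multiplicative statement
  have hprod : Real.logb 2 ((L : ℝ) * (N : ℝ) ^ (2 + η)) = X + (2 + η) * Y := by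
    rw [Real.logb_mul hLpos.ne' (Real.rpow_pos_of_pos hNpos _).ne',
      Real.logb_rpow_eq_mul_logb_of_pos hNpos]
  have hpos : (0 : ℝ) < (L : ℝ) * (N : ℝ) ^ (2 + η) := mul_pos hLpos (Real.rpow_pos_of_pos hNpos _)
  rw [← Real.logb_lt_logb_iff one_lt_two hpos hHpos, hprod]
  exact hlog

/-! ### The composition: the three stubs imply the crux, by name -/

/-- **`RectangularThmB` from the three stubs** (sorry-free). For `ℓ`, `a ∈ (0,1)`: `κ` from the
regime lemma, `ν := κ / (2 (1 − a))` (so `ν (1 − a) = κ/2 < κ`), `η₁` from the small-block regime,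
`η₂` from `stub_hugeBlocks` at `(ℓ, ν, a)`, `η := min η₁ η₂`; a family either has `|H|^ν ≤ N` (huge
blocks: `η₂`) or `N < |H|^ν` (small blocks: `η₁`), and `L N^{2+η} ≤ L N^{2+ηᵢ}` since `N ≥ 2`. -/
theorem RectangularThmB_of (hA : Registered.stub_functionalPacking)
    (hB : Registered.stub_supportEntropyGap) (hC : Registered.stub_hugeBlocks) :
    Theses.ThinBlockAlpha.RectangularThmB := by
  have hS : SmallBlocks := smallBlocks_of hA hB
  intro ℓ a ha0 ha1
  obtain ⟨κ, hκ, hsmall⟩ := hS ℓ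
  have h1a : 0 < 1 - a := by linarith
  set ν : ℝ := κ / (2 * (1 - a)) with hνdef
  have hν : 0 < ν := by positivity
  have hνκ : ν * (1 - a) < κ := by
    have e : ν * (1 - a) = κ / 2 := by
      rw [hνdef]
      field_simp
    rw [e]
    linarith
  obtain ⟨η₁, hη₁, hsm⟩ := hsmall a ha0 ha1 ν hν hνκ
  obtain ⟨η₂, hη₂, hbig⟩ := hC ℓ ν hν a ha0 ha1
  refine ⟨min η₁ η₂, lt_min hη₁ hη₂, ?_⟩
  intro H _ _ hexp L N M A B C hSTPP hc hN hM
  have hN1 : (1 : ℝ) ≤ N := by exact_mod_cast le_trans one_le_two hN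
  have hL0 : (0 : ℝ) ≤ L := Nat.cast_nonneg L
  have mono : ∀ η' : ℝ, min η₁ η₂ ≤ η' →
      (L : ℝ) * (N : ℝ) ^ (2 + min η₁ η₂) ≤ (L : ℝ) * (N : ℝ) ^ (2 + η') := fun η' hη' =>
    mul_le_mul_of_nonneg_left (Real.rpow_le_rpow_of_exponent_le hN1 (by linarith)) hL0
  by_cases hcase : (Fintype.card H : ℝ) ^ ν ≤ N
  · exact lt_of_le_of_lt (mono η₂ (min_le_right _ _))
      (hbig H hexp L N M A B C hSTPP hc hN hM hcase)
  · exact lt_of_le_of_lt (mono η₁ (min_le_left _ _))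
      (hsm H hexp L N M A B C hSTPP hc hN hM (le_of_lt (lt_of_not_ge hcase)))

/-- **No loss in the split**: the residual stub is NECESSARY — the crux implies `HugeBlocks` outright
(drop the block-size hypothesis). So, given the two provable halves of the lever,
`RectangularThmB ↔ HugeBlocks`: the line is an exact REDUCTION of the crux to its huge-block regime. -/
theorem hugeBlocks_of_rectangularThmB (h : Theses.ThinBlockAlpha.RectangularThmB) : HugeBlocks := by
  intro ℓ ν _ a ha0 ha1
  obtain ⟨η, hη, h'⟩ := h ℓ a ha0 ha1
  exact ⟨η, hη, fun H _ _ hexp L N M A B C hS hc hN hM _ => h' H hexp L N M A B C hS hc hN hM⟩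

/-- The reduction in `↔` form (modulo the two provable stubs). -/
theorem rectangularThmB_iff_hugeBlocks (hA : FunctionalPacking) (hB : SupportEntropyGap) :
    Theses.ThinBlockAlpha.RectangularThmB ↔ HugeBlocks :=
  ⟨hugeBlocks_of_rectangularThmB, fun hC => RectangularThmB_of hA hB hC⟩

/-- Wiring check: the registered stubs feed `RectangularThmB_of` as stated. -/
example : Theses.ThinBlockAlpha.RectangularThmB :=
  RectangularThmB_of stub_functionalPacking stub_supportEntropyGap stub_hugeBlocks

/-- Sanity (the lever is consistent with the landed Negative lemma it is checked against): the
two-leg translate bound `(L+1) N² ≤ |H|` of `Negative.TwoLegTranslate` is available in this file's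
scope; no stub asserts exact two-leg tightness of a single family. -/
example {H : Type} [AddCommGroup H] [Fintype H] {L N M : ℕ} {A B C : Fin L → Finset H}
    (hS : IsSTPP A B C) (hc : ∀ i, (A i).card = N ∧ (B i).card = M ∧ (C i).card = N)
    (hM : 2 ≤ M) (hL : 0 < L) : (L + 1) * N ^ 2 ≤ Fintype.card H :=
  Theorems.RectangularThmB.Negative.succ_mul_sq_le_card hS hc hM hL

end Summit.MatrixMultiplication.MatrixMultiplication.Cruxes.RectangularThmB.WeightedSupportSpectrum

end
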